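import Summits.QuantumAdvantage.QuantumAdvantage.Theorems.CubicForrelationNearExactIsExactDerivDegree
import Summits.QuantumAdvantage.QuantumAdvantage.Theorems.CubicForrelationNearExactIsExactInvariantWeight

/-!
# Crux `CubicForrelation.NearExactIsExact` (stmt-QuantumAdvantage-14043) — the CUBIC FORM (third difference) of a cubic Boolean function

Certificate seat `b2b-cforr-cert` (gen 40).  HONEST FRAMING: kernel-checked folklore bookkeeping (standard axioms) — the coordinate-free
"cubic part" of a Boolean function of degree `≤ 3`, as needed by the frames (L4) and the bridge (L6) of the Lean roadmap for the last open
case `E1280-even` of the 12-bit window (HOME/b2b-cforr-cert-g39/E1280-HANDPROOFS.md §3).  Nothing about `θ₁₂` is claimed; NOT summit progress.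

For `κ : 𝔽₂ⁿ → 𝔽₂` and vectors `u, v, w, x` the THIRD DIFFERENCE at base point `x` is the xor of `κ` over the eight points
`x ⊕ ⟨u, v, w⟩`; below it is always written in the nested form `D_u D_v D_w κ (x)`, i.e. literally
`((κ x ⊕ κ(x⊕w)) ⊕ (κ(x⊕v) ⊕ κ(x⊕v⊕w))) ⊕ ((κ(x⊕u) ⊕ κ(x⊕u⊕w)) ⊕ (κ(x⊕u⊕v) ⊕ κ(x⊕u⊕v⊕w)))`.
* `tcf_third_const`: for `deg κ ≤ 3` it does not depend on `x` (`stub_derivDegree` three times: `D_uD_vD_wκ` has degree `≤ 0`).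
* `tcf_third_swap12`, `tcf_third_swap23`, `tcf_third_diag12`, `tcf_third_zero1`: it is symmetric in `u, v, w` and vanishes when two
  arguments coincide or one is `0` (an alternating form in characteristic two).
* `tcf_third_add1` (any `κ`, with a base-point shift) and `tcf_third_add1'` (`deg κ ≤ 3`): additivity in the first argument; with
  `tcf_linear_sum` (a map `𝔽₂ᵐ → 𝔽₂` that is additive and vanishes at `0` is the sum of its values on the unit vectors) this gives the
  expansion `tcf_third_sum1` of the form on an `𝔽₂`-combination `Σ_ψ z_ψ e_ψ` in the first slot, hence (by symmetry) in every slot.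
* `tcf_cube_insert_card` / `tcf_third_cube`: the value on three distinct unit vectors `e_i, e_j, e_k` is the parity of `κ` on the coordinate
  cube `E_{ijk} = {y : supp y ⊆ {i,j,k}}` — the coefficient of `y_i y_j y_k` in the algebraic normal form, which is how
  …TwelveDigitDualForm (`tdf_cube3_class`) describes the cubic part of the digit class.
Companion file …CubicFormTransport: behaviour under affine maps `y ↦ b ⊕ P y` (the 3-form transformation law consumed by
`tps_pair_covariant` of …TwelvePartnerSymplectic).

References: C. Carlet, Boolean Functions for Cryptography and Coding Theory (CUP 2021) §2.2 (derivatives, algebraic normal form);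
F. J. MacWilliams, N. J. A. Sloane (1977) Ch. 13 §3.  Axioms: the standard three.
-/

set_option linter.dupNamespace false -- D-0017: single-problem summit ⇒ `QuantumAdvantage.QuantumAdvantage` by design

namespace Summit.QuantumAdvantage.QuantumAdvantage.Theorems.CubicForrelation.NearExactIsExact

open Finset
open Literature.Computability.QuantumComplexity
open Literature.Computability.QuantumComplexity.BuzetChailloux (bxor zeroVec bxor_comm bxor_self bxor_zeroVec zeroVec_bxor
  bxor_bxor_cancel_left)

variable {n : ℕ}

/-! ### Small vector and Boolean facts -/

/-- Scaling a vector by the bit `true` / `false`. [folklore] -/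
theorem tcf_smul_true (u : Fin n → Bool) : (fun i => true && u i) = u := by
  funext i; exact Bool.true_and _

/-- Scaling a vector by the bit `false` gives `0`. [folklore] -/
theorem tcf_smul_false (u : Fin n → Bool) : (fun i => false && u i) = (zeroVec : Fin n → Bool) := by
  funext i; rfl

/-! ### The third difference: base-point independence, symmetry, alternation -/

section Third

variable (κ : (Fin n → Bool) → Bool)

/-- **Base-point independence.**  For `deg κ ≤ 3` the third difference `D_uD_vD_wκ(x)` does not depend on `x`
(three applications of `stub_derivDegree` leave a function of degree `≤ 0`). [cite: Carlet2020, §2.2] -/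
theorem tcf_third_const (hκ : IsDegLeFun 3 κ) (u v w x x' : Fin n → Bool) :
    (((κ x ^^ κ (bxor x w)) ^^ (κ (bxor x v) ^^ κ (bxor (bxor x v) w))) ^^
        ((κ (bxor x u) ^^ κ (bxor (bxor x u) w)) ^^ (κ (bxor (bxor x u) v) ^^ κ (bxor (bxor (bxor x u) v) w)))) =
      (((κ x' ^^ κ (bxor x' w)) ^^ (κ (bxor x' v) ^^ κ (bxor (bxor x' v) w))) ^^
        ((κ (bxor x' u) ^^ κ (bxor (bxor x' u) w)) ^^ (κ (bxor (bxor x' u) v) ^^ κ (bxor (bxor (bxor x' u) v) w)))) := by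
  have h2 : IsDegLeFun 2 (fun x => κ x ^^ κ (bxor x w)) := stub_derivDegree n 2 κ w hκ
  have h1 : IsDegLeFun 1 (fun x => (fun x => κ x ^^ κ (bxor x w)) x ^^ (fun x => κ x ^^ κ (bxor x w)) (bxor x v)) :=
    stub_derivDegree n 1 _ v h2
  obtain ⟨p, hp, hF⟩ := stub_derivDegree n 0 _ u h1
  have hpC : p = MvPolynomial.C (p.coeff 0) := MvPolynomial.totalDegree_eq_zero_iff_eq_C.mp (Nat.le_zero.mp hp)
  have e1 := hF x
  have e2 := hF x'
  rw [hpC, polyPhase_C] at e1 e2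
  exact e1.trans e2.symm

/-- Symmetry in the last two arguments (any `κ`, any base point). [folklore] -/
theorem tcf_third_swap23 (u v w x : Fin n → Bool) :
    (((κ x ^^ κ (bxor x w)) ^^ (κ (bxor x v) ^^ κ (bxor (bxor x v) w))) ^^
        ((κ (bxor x u) ^^ κ (bxor (bxor x u) w)) ^^ (κ (bxor (bxor x u) v) ^^ κ (bxor (bxor (bxor x u) v) w)))) =
      (((κ x ^^ κ (bxor x v)) ^^ (κ (bxor x w) ^^ κ (bxor (bxor x w) v))) ^^
        ((κ (bxor x u) ^^ κ (bxor (bxor x u) v)) ^^ (κ (bxor (bxor x u) w) ^^ κ (bxor (bxor (bxor x u) w) v)))) := by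
  have e1 : bxor (bxor x w) v = bxor (bxor x v) w := by rw [iw_bxor_assoc x w v, iw_bxor_assoc x v w, bxor_comm w v]
  have e2 : bxor (bxor (bxor x u) w) v = bxor (bxor (bxor x u) v) w := by
    rw [iw_bxor_assoc (bxor x u) w v, iw_bxor_assoc (bxor x u) v w, bxor_comm w v]
  rw [e1, e2]
  have key : ∀ a b c d e f g h : Bool,
      (((a ^^ b) ^^ (c ^^ d)) ^^ ((e ^^ f) ^^ (g ^^ h))) = (((a ^^ c) ^^ (b ^^ d)) ^^ ((e ^^ g) ^^ (f ^^ h))) := by decide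
  exact key _ _ _ _ _ _ _ _

/-- Symmetry in the first two arguments (any `κ`, any base point). [folklore] -/
theorem tcf_third_swap12 (u v w x : Fin n → Bool) :
    (((κ x ^^ κ (bxor x w)) ^^ (κ (bxor x v) ^^ κ (bxor (bxor x v) w))) ^^
        ((κ (bxor x u) ^^ κ (bxor (bxor x u) w)) ^^ (κ (bxor (bxor x u) v) ^^ κ (bxor (bxor (bxor x u) v) w)))) =
      (((κ x ^^ κ (bxor x w)) ^^ (κ (bxor x u) ^^ κ (bxor (bxor x u) w))) ^^
        ((κ (bxor x v) ^^ κ (bxor (bxor x v) w)) ^^ (κ (bxor (bxor x v) u) ^^ κ (bxor (bxor (bxor x v) u) w)))) := by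
  have e1 : bxor (bxor x v) u = bxor (bxor x u) v := by rw [iw_bxor_assoc x v u, iw_bxor_assoc x u v, bxor_comm v u]
  rw [e1]
  have key : ∀ a b c d e f g h : Bool,
      (((a ^^ b) ^^ (c ^^ d)) ^^ ((e ^^ f) ^^ (g ^^ h))) = (((a ^^ b) ^^ (e ^^ f)) ^^ ((c ^^ d) ^^ (g ^^ h))) := by decide
  exact key _ _ _ _ _ _ _ _

/-- The third difference vanishes when the first two arguments coincide. [folklore] -/
theorem tcf_third_diag12 (u w x : Fin n → Bool) :
    (((κ x ^^ κ (bxor x w)) ^^ (κ (bxor x u) ^^ κ (bxor (bxor x u) w))) ^^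
        ((κ (bxor x u) ^^ κ (bxor (bxor x u) w)) ^^ (κ (bxor (bxor x u) u) ^^ κ (bxor (bxor (bxor x u) u) w)))) = false := by
  have hc : bxor (bxor x u) u = x := by rw [iw_bxor_assoc, bxor_self, bxor_zeroVec]
  rw [hc]
  have key : ∀ a b c d : Bool, (((a ^^ b) ^^ (c ^^ d)) ^^ ((c ^^ d) ^^ (a ^^ b))) = false := by decide
  exact key _ _ _ _

/-- The third difference vanishes when the first argument is `0`. [folklore] -/
theorem tcf_third_zero1 (v w x : Fin n → Bool) :
    (((κ x ^^ κ (bxor x w)) ^^ (κ (bxor x v) ^^ κ (bxor (bxor x v) w))) ^^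
        ((κ (bxor x zeroVec) ^^ κ (bxor (bxor x zeroVec) w)) ^^
          (κ (bxor (bxor x zeroVec) v) ^^ κ (bxor (bxor (bxor x zeroVec) v) w)))) = false := by
  rw [bxor_zeroVec]
  have key : ∀ a b c d : Bool, (((a ^^ b) ^^ (c ^^ d)) ^^ ((a ^^ b) ^^ (c ^^ d))) = false := by decide
  exact key _ _ _ _

/-- **Additivity in the first argument, with base-point shift** (any `κ`):
`D_{u⊕u'}D_vD_wκ(x) = D_uD_vD_wκ(x) ⊕ D_{u'}D_vD_wκ(x ⊕ u)`. [folklore] -/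
theorem tcf_third_add1 (u u' v w x : Fin n → Bool) :
    (((κ x ^^ κ (bxor x w)) ^^ (κ (bxor x v) ^^ κ (bxor (bxor x v) w))) ^^
        ((κ (bxor x (bxor u u')) ^^ κ (bxor (bxor x (bxor u u')) w)) ^^
          (κ (bxor (bxor x (bxor u u')) v) ^^ κ (bxor (bxor (bxor x (bxor u u')) v) w)))) =
      ((((κ x ^^ κ (bxor x w)) ^^ (κ (bxor x v) ^^ κ (bxor (bxor x v) w))) ^^
          ((κ (bxor x u) ^^ κ (bxor (bxor x u) w)) ^^ (κ (bxor (bxor x u) v) ^^ κ (bxor (bxor (bxor x u) v) w)))) ^^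
        (((κ (bxor x u) ^^ κ (bxor (bxor x u) w)) ^^ (κ (bxor (bxor x u) v) ^^ κ (bxor (bxor (bxor x u) v) w))) ^^
          ((κ (bxor (bxor x u) u') ^^ κ (bxor (bxor (bxor x u) u') w)) ^^
            (κ (bxor (bxor (bxor x u) u') v) ^^ κ (bxor (bxor (bxor (bxor x u) u') v) w))))) := by
  rw [← iw_bxor_assoc x u u']
  have key : ∀ A B C : Bool, (A ^^ C) = ((A ^^ B) ^^ (B ^^ C)) := by decide
  exact key _ _ _

/-- **Additivity in the first argument** for `deg κ ≤ 3` (same base point on both sides). [cite: Carlet2020, §2.2] -/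
theorem tcf_third_add1' (hκ : IsDegLeFun 3 κ) (u u' v w x : Fin n → Bool) :
    (((κ x ^^ κ (bxor x w)) ^^ (κ (bxor x v) ^^ κ (bxor (bxor x v) w))) ^^
        ((κ (bxor x (bxor u u')) ^^ κ (bxor (bxor x (bxor u u')) w)) ^^
          (κ (bxor (bxor x (bxor u u')) v) ^^ κ (bxor (bxor (bxor x (bxor u u')) v) w)))) =
      ((((κ x ^^ κ (bxor x w)) ^^ (κ (bxor x v) ^^ κ (bxor (bxor x v) w))) ^^
          ((κ (bxor x u) ^^ κ (bxor (bxor x u) w)) ^^ (κ (bxor (bxor x u) v) ^^ κ (bxor (bxor (bxor x u) v) w)))) ^^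
        (((κ x ^^ κ (bxor x w)) ^^ (κ (bxor x v) ^^ κ (bxor (bxor x v) w))) ^^
          ((κ (bxor x u') ^^ κ (bxor (bxor x u') w)) ^^ (κ (bxor (bxor x u') v) ^^ κ (bxor (bxor (bxor x u') v) w))))) := by
  rw [tcf_third_add1 κ u u' v w x, tcf_third_const κ hκ u' v w (bxor x u) x]

/-- Scaling the first argument by a bit `b` scales the third difference by `b`. [folklore] -/
theorem tcf_third_smul1 (b : Bool) (u v w x : Fin n → Bool) :
    (((κ x ^^ κ (bxor x w)) ^^ (κ (bxor x v) ^^ κ (bxor (bxor x v) w))) ^^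
        ((κ (bxor x (fun i => b && u i)) ^^ κ (bxor (bxor x (fun i => b && u i)) w)) ^^
          (κ (bxor (bxor x (fun i => b && u i)) v) ^^ κ (bxor (bxor (bxor x (fun i => b && u i)) v) w)))) =
      (b && (((κ x ^^ κ (bxor x w)) ^^ (κ (bxor x v) ^^ κ (bxor (bxor x v) w))) ^^
        ((κ (bxor x u) ^^ κ (bxor (bxor x u) w)) ^^ (κ (bxor (bxor x u) v) ^^ κ (bxor (bxor (bxor x u) v) w))))) := by
  cases b
  · rw [tcf_smul_false, Bool.false_and]
    exact tcf_third_zero1 κ v w x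
  · rw [tcf_smul_true, Bool.true_and]

end Third

/-! ### Additive maps `𝔽₂ᵐ → 𝔽₂` are determined by the unit vectors -/

/-- `[a + b = 1] = [a = 1] ⊕ [b = 1]` in `𝔽₂`. [folklore] -/
theorem tcf_decide_add (a b : ZMod 2) : decide (a + b = 1) = (decide (a = 1) ^^ decide (b = 1)) := by
  revert a b; decide

/-- `[A ⊕ B] = [A] + [B]` read in `𝔽₂`. [folklore] -/
theorem tcf_ite_xor (A B : Bool) :
    (if (A ^^ B) = true then (1 : ZMod 2) else 0) = (if A = true then (1 : ZMod 2) else 0) + (if B = true then 1 else 0) := by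
  revert A B; decide

/-- **Linear expansion.**  A map `f : 𝔽₂ᵐ → 𝔽₂` with `f 0 = 0` and `f(u ⊕ u') = f u ⊕ f u'` satisfies
`f(Σ_i z_i e_i) = Σ_i z_i f(e_i)` for every coefficient vector `z ∈ 𝔽₂ᵐ` (the vector `Σ_i z_i e_i` is `i ↦ [z_i = 1]`). [folklore] -/
theorem tcf_linear_sum {m : ℕ} (f : (Fin m → Bool) → Bool) (h0 : f zeroVec = false)
    (hadd : ∀ u u', f (bxor u u') = (f u ^^ f u')) (z : Fin m → ZMod 2) :
    (if f (fun i => decide (z i = 1)) = true then (1 : ZMod 2) else 0) =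
      ∑ i, z i * (if f (fun l => decide (l = i)) = true then (1 : ZMod 2) else 0) := by
  classical
  -- induction over the support, with the partial vectors `v_s = Σ_{i ∈ s} z_i e_i`
  have key : ∀ s : Finset (Fin m), (if f (fun i => decide (i ∈ s ∧ z i = 1)) = true then (1 : ZMod 2) else 0) =
      ∑ i ∈ s, z i * (if f (fun l => decide (l = i)) = true then (1 : ZMod 2) else 0) := by
    intro s
    induction s using Finset.induction_on with
    | empty =>
      have hv : (fun i => decide (i ∈ (∅ : Finset (Fin m)) ∧ z i = 1)) = (zeroVec : Fin m → Bool) := by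
        funext i; simp [zeroVec]
      rw [hv, h0, sum_empty]; rfl
    | insert a s ha ih =>
      have hv : (fun i => decide (i ∈ insert a s ∧ z i = 1)) =
          bxor (fun i => decide (i = a ∧ z a = 1)) (fun i => decide (i ∈ s ∧ z i = 1)) := by
        funext i
        show decide (i ∈ insert a s ∧ z i = 1) = (decide (i = a ∧ z a = 1) ^^ decide (i ∈ s ∧ z i = 1))
        by_cases hia : i = a
        · subst hia
          simp [ha]
        · simp [mem_insert, hia]
      rw [hv, hadd, tcf_ite_xor, ih, sum_insert ha]
      congr 1
      -- the single term `z_a f(e_a)`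
      by_cases hz : z a = 1
      · have hv1 : (fun i => decide (i = a ∧ z a = 1)) = fun l => decide (l = a) := by
          funext i; simp [hz]
        rw [hv1, hz, one_mul]
      · have hz0 : z a = 0 := by
          have : ∀ t : ZMod 2, t ≠ 1 → t = 0 := by decide
          exact this _ hz
        have hv0 : (fun i => decide (i = a ∧ z a = 1)) = (zeroVec : Fin m → Bool) := by
          funext i; simp [hz0, zeroVec]
        rw [hv0, h0, hz0, zero_mul]; rfl
  have hu : (fun i => decide (z i = 1)) = fun i => decide (i ∈ (univ : Finset (Fin m)) ∧ z i = 1) := by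
    funext i; simp
  rw [hu, key univ]

/-! ### The form on an `𝔽₂`-combination in the first slot -/

section Sum

variable (κ : (Fin n → Bool) → Bool)

/-- **Expansion in the first slot.**  For `deg κ ≤ 3` and a coefficient vector `z ∈ 𝔽₂ⁿ`:
`D_{Σ z_ψ e_ψ} D_v D_w κ = Σ_ψ z_ψ · D_{e_ψ} D_v D_w κ` (read in `𝔽₂`). [cite: Carlet2020, §2.2] -/
theorem tcf_third_sum1 (hκ : IsDegLeFun 3 κ) (z : Fin n → ZMod 2) (v w x : Fin n → Bool) :
    (if ((((κ x ^^ κ (bxor x w)) ^^ (κ (bxor x v) ^^ κ (bxor (bxor x v) w))) ^^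
        ((κ (bxor x (fun i => decide (z i = 1))) ^^ κ (bxor (bxor x (fun i => decide (z i = 1))) w)) ^^
          (κ (bxor (bxor x (fun i => decide (z i = 1))) v) ^^ κ (bxor (bxor (bxor x (fun i => decide (z i = 1))) v) w))))) = true
      then (1 : ZMod 2) else 0) =
      ∑ ψ, z ψ * (if ((((κ x ^^ κ (bxor x w)) ^^ (κ (bxor x v) ^^ κ (bxor (bxor x v) w))) ^^
        ((κ (bxor x (fun l => decide (l = ψ))) ^^ κ (bxor (bxor x (fun l => decide (l = ψ))) w)) ^^
          (κ (bxor (bxor x (fun l => decide (l = ψ))) v) ^^ κ (bxor (bxor (bxor x (fun l => decide (l = ψ))) v) w))))) = true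
        then (1 : ZMod 2) else 0) := by
  refine tcf_linear_sum (fun u => (((κ x ^^ κ (bxor x w)) ^^ (κ (bxor x v) ^^ κ (bxor (bxor x v) w))) ^^
        ((κ (bxor x u) ^^ κ (bxor (bxor x u) w)) ^^ (κ (bxor (bxor x u) v) ^^ κ (bxor (bxor (bxor x u) v) w))))) ?_ ?_ z
  · exact tcf_third_zero1 κ v w x
  · intro u u'
    exact tcf_third_add1' κ hκ u u' v w x

end Sum

/-! ### Coordinate cubes: the value on three unit vectors is the cube parity -/

/-- **Splitting a coordinate cube along one coordinate.**  For `i ∉ I`, the cube of `insert i I` is the cube of `I` together with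
its translate by `e_i`, so `#{y ∈ E_{I ∪ {i}} : κ y} = #{y ∈ E_I : κ y} + #{y ∈ E_I : κ(y ⊕ e_i)}`. [folklore] -/
theorem tcf_cube_insert_card (κ : (Fin n → Bool) → Bool) (I : Finset (Fin n)) (i : Fin n) (hi : i ∉ I) :
    #((univ.filter fun y : Fin n → Bool => ∀ l, y l = true → l ∈ insert i I).filter fun y => κ y = true) =
      #((univ.filter fun y : Fin n → Bool => ∀ l, y l = true → l ∈ I).filter fun y => κ y = true) +
        #((univ.filter fun y : Fin n → Bool => ∀ l, y l = true → l ∈ I).filter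
          fun y => κ (bxor y (fun l => decide (l = i))) = true) := by
  classical
  have hcancel : ∀ y : Fin n → Bool, bxor (bxor y (fun l => decide (l = i))) (fun l => decide (l = i)) = y := fun y => by
    rw [iw_bxor_assoc, bxor_self, bxor_zeroVec]
  set C : Finset (Fin n → Bool) := univ.filter fun y : Fin n → Bool => ∀ l, y l = true → l ∈ I with hC
  -- the cube of `insert i I` splits by the value of the `i`-th coordinate
  have hsplit : (univ.filter fun y : Fin n → Bool => ∀ l, y l = true → l ∈ insert i I) =
      C ∪ C.image fun y => bxor y (fun l => decide (l = i)) := by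
    ext y
    simp only [hC, mem_union, mem_filter, mem_univ, true_and, mem_image, mem_insert]
    constructor
    · intro hy
      by_cases hyi : y i = true
      · right
        refine ⟨bxor y (fun l => decide (l = i)), fun l hl => ?_, hcancel y⟩
        by_cases hli : l = i
        · subst hli
          simp [hyi] at hl
        · have hl' : y l = true := by simpa [hli] using hl
          rcases hy l hl' with h | h
          · exact absurd h hli
          · exact h
      · left
        intro l hl
        rcases hy l hl with h | h
        · subst h; exact absurd hl hyi
        · exact h
    · rintro (hy | ⟨y', hy', rfl⟩)
      · exact fun l hl => Or.inr (hy l hl)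
      · intro l hl
        by_cases hli : l = i
        · exact Or.inl hli
        · have : y' l = true := by simpa [hli] using hl
          exact Or.inr (hy' l this)
  have hdisj : Disjoint C (C.image fun y => bxor y (fun l => decide (l = i))) := by
    rw [disjoint_left]
    rintro y hy hy'
    simp only [hC, mem_filter, mem_univ, true_and, mem_image] at hy hy'
    obtain ⟨y', hy', rfl⟩ := hy'
    have h1 : (bxor y' (fun l => decide (l = i))) i = true := by
      have : y' i = false := by
        by_contra hc
        exact hi (hy' i (by simpa using hc))
      simp [this]
    exact hi (hy i h1)
  have hinj : Set.InjOn (fun y : Fin n → Bool => bxor y (fun l => decide (l = i))) ↑C := by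
    intro y _ y' _ h
    have := congrArg (fun t => bxor t (fun l => decide (l = i))) h
    simpa only [hcancel] using this
  rw [hsplit, filter_union, card_union_of_disjoint (disjoint_filter_filter hdisj), filter_image,
    card_image_of_injOn (fun y hy y' hy' h => hinj (mem_of_mem_filter y hy) (mem_of_mem_filter y' hy') h)]

/-- The cube of `∅` is `{0}`: `#{y ∈ E_∅ : κ y} = [κ 0]`. [folklore] -/
theorem tcf_cube_empty_card (κ : (Fin n → Bool) → Bool) :
    #((univ.filter fun y : Fin n → Bool => ∀ l, y l = true → l ∈ (∅ : Finset (Fin n))).filter fun y => κ y = true) =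
      if κ zeroVec = true then 1 else 0 := by
  have hC : (univ.filter fun y : Fin n → Bool => ∀ l, y l = true → l ∈ (∅ : Finset (Fin n))) = {zeroVec} := by
    ext y
    simp only [mem_filter, mem_univ, true_and, notMem_empty, imp_false, Bool.not_eq_true, mem_singleton]
    constructor
    · intro h; funext l; exact h l
    · rintro rfl l; rfl
  rw [hC, filter_singleton]
  split_ifs <;> simp

/-- **The value on three distinct unit vectors is the cube parity.**  For pairwise distinct `i, j, k`:
`D_{e_i}D_{e_j}D_{e_k}κ(0) = #{y ∈ E_{ijk} : κ y} mod 2` — the coefficient of `y_iy_jy_k` in the algebraic normal form of `κ`.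
[cite: Carlet2020, §2.2] -/
theorem tcf_third_cube (κ : (Fin n → Bool) → Bool) (i j k : Fin n) (hij : i ≠ j) (hik : i ≠ k) (hjk : j ≠ k) :
    (((κ zeroVec ^^ κ (bxor zeroVec (fun l => decide (l = k)))) ^^
        (κ (bxor zeroVec (fun l => decide (l = j))) ^^ κ (bxor (bxor zeroVec (fun l => decide (l = j))) (fun l => decide (l = k))))) ^^
      ((κ (bxor zeroVec (fun l => decide (l = i))) ^^ κ (bxor (bxor zeroVec (fun l => decide (l = i))) (fun l => decide (l = k)))) ^^
        (κ (bxor (bxor zeroVec (fun l => decide (l = i))) (fun l => decide (l = j))) ^^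
          κ (bxor (bxor (bxor zeroVec (fun l => decide (l = i))) (fun l => decide (l = j))) (fun l => decide (l = k)))))) =
      decide (Odd #((univ.filter fun y : Fin n → Bool => ∀ l, y l = true → l ∈ ({i, j, k} : Finset (Fin n))).filter
        fun y => κ y = true)) := by
  have hi : i ∉ ({j, k} : Finset (Fin n)) := by simp [hij, hik]
  have hj : j ∉ ({k} : Finset (Fin n)) := by simp [hjk]
  have hk : k ∉ (∅ : Finset (Fin n)) := notMem_empty k
  have e3 : ({i, j, k} : Finset (Fin n)) = insert i {j, k} := rfl
  have e2 : ({j, k} : Finset (Fin n)) = insert j {k} := rfl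
  have e1 : ({k} : Finset (Fin n)) = insert k ∅ := rfl
  rw [e3, tcf_cube_insert_card _ _ i hi, e2, tcf_cube_insert_card _ _ j hj, tcf_cube_insert_card _ _ j hj, e1,
    tcf_cube_insert_card _ _ k hk, tcf_cube_insert_card _ _ k hk, tcf_cube_insert_card _ _ k hk, tcf_cube_insert_card _ _ k hk,
    tcf_cube_empty_card, tcf_cube_empty_card, tcf_cube_empty_card, tcf_cube_empty_card, tcf_cube_empty_card, tcf_cube_empty_card,
    tcf_cube_empty_card, tcf_cube_empty_card]
  have hodd : ∀ a b : ℕ, decide (Odd (a + b)) = (decide (Odd a) ^^ decide (Odd b)) := by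
    intro a b
    rcases Nat.even_or_odd a with ha | ha <;> rcases Nat.even_or_odd b with hb | hb
    · simp [Nat.not_odd_iff_even.2 (Even.add ha hb), Nat.not_odd_iff_even.2 ha, Nat.not_odd_iff_even.2 hb]
    · simp [Even.add_odd ha hb, Nat.not_odd_iff_even.2 ha, hb]
    · simp [Odd.add_even ha hb, ha, Nat.not_odd_iff_even.2 hb]
    · simp [Nat.not_odd_iff_even.2 (Odd.add_odd ha hb), ha, hb]
  simp only [hodd, zeroVec_bxor]
  have hb : ∀ b : Bool, decide (Odd (if b = true then 1 else 0)) = b := by decide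
  simp only [hb]
  -- reorder the translates (`e_k ⊕ e_j = e_j ⊕ e_k`, …)
  have e4 : bxor (bxor (fun l => decide (l = j)) (fun l => decide (l = k))) (fun l : Fin n => decide (l = i)) =
      bxor (bxor (fun l => decide (l = i)) (fun l => decide (l = j))) (fun l => decide (l = k)) := by
    rw [bxor_comm, iw_bxor_assoc]
  rw [bxor_comm (fun l => decide (l = k)) (fun l => decide (l = j)), bxor_comm (fun l => decide (l = k)) (fun l => decide (l = i)),
    bxor_comm (fun l => decide (l = j)) (fun l => decide (l = i)), e4]

end Summit.QuantumAdvantage.QuantumAdvantage.Theorems.CubicForrelation.NearExactIsExact
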